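import Literature.NumberTheory.GaloisCohomology.PoitouTateRestrictedShaDualOfReadout
import Literature.Algebra.Homology.ExtPresentationBoundary
import Literature.Algebra.Homology.ExtDualityPairing
import HarnessLib

/-!
# The `S`-restricted `Ш²`-readout road (finite `S`): ONE pairing `Ш²_S(K, M) × Ш¹_S(K, M^D) → ℚ/ℤ`,
# defined from a presentation and a degree-`2` obstruction map, and its perfectness (Milne I Thm. 4.10 (a))

Topic `NumberTheory/GaloisCohomology`; namespace `Literature.NumberTheory.GaloisCohomology`.  Definitions
WITH BODIES (`ShaReadoutRoad.levelFunctional`, `ShaReadoutRoad.shaLift`, **`ShaReadoutRoad.levelPairing`**)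
and theorems; no named fact, no `sorry`, no instance, no notation.  Lane «PT-Ш-S-TC» of cell `bsd-eis`
(crux `GoodLatticeBDPValue`), brick D5a: the `S`-version (finite `S`, `Σ = S ∪ Ω_∞`) of the tree's
`PoitouTateShaTwoReadout.shaTwo_tateDual_of_presentation_readout(_real)` (seats chl-p2 g7 / inputs-k4-p1,
all places), with the pairing a DEFINITION (lane rule: "`B` one function of the module, never `∃ b`",
LEAD ROUTING #7 (2)) so that its NATURALITY in the module (brick D5b) can be stated about it.

ABSTRACT IN THE CATEGORY.  Nothing on the `Ext` side uses that the group is `G_S`: the road is stated for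
ANY abelian category `𝒞` with `Ext` groups (door-c4's engine instantiates it with `C_{G_S}`), objects
`P` ("`ℤ`"), `CS` ("`C̄_S`"), `JS` ("`J̄_S`") with `gJ : JS ⟶ CS`, a short exact `SC : 0 → N₁ → N₂ → N₃ → 0`
(a presentation), an additive `inv : Ext²(P, CS) → ℚ/ℤ` (Tate duality for the class formation enters
only through `hα`: `α¹(N₃)` bijective, and `hPC`: `Ext¹(N₂, CS) = 0`), and three BRIDGES to Galois
cohomology — the readouts `R_v : Hom(N₁, JS) → H¹(K_v, M)` (`v ∈ Σ`), `nat : H¹(G_S, M^D) → Ext¹(P, N₃)`,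
and the obstruction map `Ψ : Hom(N₁, CS) → H²(G_S, M^{N_S})` — with the displayed identities (R3)/(R4)
and the five properties of `Ψ`.  On the Galois side: `Hⁿ(G_S, ·^{N_S}) = restrictedCohomology`,
`Шⁿ_S = shaRestricted`, `restrictedLocalization`, local Tate pairings `localTatePairingZMod` for a
family `linv` of local invariant maps, summed over a finite set `Sig` of places = "`S` and the infinite
places".

* §0 `bijective_addCircle_pairing_of_zmod` — a `ℚ/ℤ`-valued pairing that lifts a perfect `ℤ/n`-valued
  one on `n`-torsion groups is perfect.
* §1 `levelFunctional hSC inv nat h : H¹(G_S, M^D) →+ ℚ/ℤ`, `y ↦ inv (nat y ∘ ∂h)` (additive in `h`);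
  (R4) read on it (`levelFunctional_comp_g`); two `Ψ`-equal `h` have functionals that AGREE ON `Ш¹_S`
  (`levelFunctional_eq_of_obstruction_eq`: they differ by `f ≫ gJ` plus `ι ≫ q`, whose functionals are a
  `Σ`-local sum resp. zero);
* §2 **`levelPairing … : ↥Ш²_S(K, M) →+ ↥Ш¹_S(K, M^D) →+ ℚ/ℤ`**, `c ↦ (z ↦ inv (nat z ∘ ∂h_c))` for ANY
  `Ψ`-lift `h_c` of `c` (`levelPairing_apply_of_eq`) — the definition uses a chosen lift, the value does not;
* §3 **`levelPairing_perfect`** — `Ш²_S(K, M)` is finite and both adjoints of `levelPairing` are bijective: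
  the `ℤ/n`-valued readout `e(c) = ` lift of `levelFunctional h_c` satisfies (add)/(inj)/(surj) modulo
  `Σ`-local sums exactly as on chl-p2's road ((R3), (R4), `Ψ`'s properties, `α¹` bijective, `Ext¹(N₂, CS) = 0`),
  `PoitouTateRestrictedShaDualOfReadout.shaRestricted_tateDual_of_readout` makes it perfect, §0 transports.

HONEST FRAMING: a reduction with displayed hypotheses (the bridges and the class-formation inputs are
NOT constructed here); no case of Poitou–Tate duality and nothing about BSD is proved.
AI formalisation, weaker than expert review; established only by the kernel check.

## References
* J. S. Milne, *Arithmetic Duality Theorems*, 2nd ed. (2006), I Thm. 4.10 (a) and its proof (p. 58),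
  I Lemma 4.13, I §0 Prop. 0.19. [MilneADT2006]
* D. Harari, *Galois Cohomology and Class Field Theory* (2020), §16.2–16.3 (the maps `α`), Thm. 17.13 (b),
  §17.5. [Harari2020]
-/

noncomputable section

open Function NumberField IsDedekindDomain CategoryTheory CategoryTheory.Abelian
open scoped NumberField

universe w v u

namespace Literature.NumberTheory.GaloisCohomology

open Literature.NumberTheory.GaloisRepresentations
open Literature.NumberTheory.GaloisRepresentations.DiscreteGaloisModule (TateDual tateDual
  restrictedCohomology restrictedLocalization shaRestricted localTatePairingZMod)
open Literature.Algebra.Homology Literature.Algebra.Homology.ExtPresentation Literature.Algebra.Homology.ExtDuality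
open Literature.AnabelianGeometry.AbsoluteAnabelian.Prop121vii (zmodToQmodZ zmodToQmodZ_injective)

/-! ## §0 `ℚ/ℤ`-valued pairings lifting perfect `ℤ/n`-valued ones -/

section ZModToAddCircle

variable {X Y : Type*} [AddCommGroup X] [AddCommGroup Y] (n : ℕ) [NeZero n]

/-- **A `ℚ/ℤ`-valued pairing on `n`-torsion groups whose values are those of a PERFECT `ℤ/n`-valued
pairing read in `(1/n)ℤ/ℤ` is perfect** (both adjoints bijective): injectivity through `ℤ/n ↪ ℚ/ℤ`,
surjectivity because every character of an `n`-torsion group factors through `ℤ/n`.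
[cite: MilneADT2006, I §0 Prop. 0.19] -/
theorem bijective_addCircle_pairing_of_zmod (hX : ∀ x : X, n • x = 0) (hY : ∀ y : Y, n • y = 0)
    (b : X →+ Y →+ ZMod n) (B : X →+ Y →+ AddCircle (1 : ℚ))
    (hbB : ∀ x y, zmodToQmodZ n (b x y) = B x y) (hb : Bijective b) (hb' : Bijective b.flip) :
    Bijective B ∧ Bijective B.flip := by
  have hBx : ∀ x, B x = (zmodToQmodZ n).comp (b x) := fun x => AddMonoidHom.ext fun y => (hbB x y).symm
  have hBy : ∀ y, B.flip y = (zmodToQmodZ n).comp (b.flip y) := fun y =>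
    AddMonoidHom.ext fun x => by rw [AddMonoidHom.flip_apply, AddMonoidHom.comp_apply,
      AddMonoidHom.flip_apply, hbB]
  refine ⟨⟨fun x x' h => hb.1 ?_, fun g => ?_⟩, ⟨fun y y' h => hb'.1 ?_, fun g => ?_⟩⟩
  · apply zmodToQmodZ_comp_injective (Y := Y) n
    change (zmodToQmodZ n).comp (b x) = (zmodToQmodZ n).comp (b x')
    rw [← hBx, ← hBx, h]
  · obtain ⟨g', hg'⟩ := exists_zmodToQmodZ_comp_eq n hY g
    obtain ⟨x, hx⟩ := hb.2 g'
    exact ⟨x, by rw [hBx, hx, hg']⟩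
  · apply zmodToQmodZ_comp_injective (Y := X) n
    change (zmodToQmodZ n).comp (b.flip y) = (zmodToQmodZ n).comp (b.flip y')
    rw [← hBy, ← hBy, h]
  · obtain ⟨g', hg'⟩ := exists_zmodToQmodZ_comp_eq n hX g
    obtain ⟨y, hy⟩ := hb'.2 g'
    exact ⟨y, by rw [hBy, hy, hg']⟩

end ZModToAddCircle

namespace ShaReadoutRoad

variable {K : Type} [Field K] {M : Type} [AddCommGroup M] [TopologicalSpace M]
  [DiscreteTopology M] [Finite M] {n : ℕ}
  (ρ : DiscreteGaloisModule K M) (S : Set (HeightOneSpectrum (𝓞 K)))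
  {𝒞 : Type u} [Category.{v} 𝒞] [Abelian 𝒞] [HasExt.{w} 𝒞]
  {P CS : 𝒞} (inv : Ext P CS 2 →+ AddCircle (1 : ℚ))
  {SC : ShortComplex 𝒞} (hSC : SC.ShortExact)
  (nat : restrictedCohomology (ρ.tateDual n) S 1 →+ Ext P SC.X₃ 1)

/-! ## §1 The functional `y ↦ inv (nat y ∘ ∂h)` of a homomorphism `h : N₁ → C̄_S` -/

/-- **The `ℚ/ℤ`-valued functional of `h : N₁ ⟶ CS` on `H¹(G_S, M^D)`**, `y ↦ inv (nat y ∘ ∂h)` — `∂` the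
boundary `Hom(N₁, CS) → Ext¹(N₃, CS)` of the presentation, `inv (· ∘ ·)` the duality pairing `α¹(N₃)`
(`ExtDuality.adjointMap`); additive in `h`. [cite: MilneADT2006, I Thm. 4.10 (a) (proof, p. 58)]
[cite: Harari2020, §16.3 and §17.5] -/
def levelFunctional : (SC.X₁ ⟶ CS) →+ (restrictedCohomology (ρ.tateDual n) S 1 →+ AddCircle (1 : ℚ)) :=
  AddMonoidHom.mk' (fun h => (ExtDuality.adjointMap (P := P) inv SC.X₃ (rfl : 1 + 1 = 2)
      (boundary hSC CS h)).comp nat)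
    (fun h h' => by rw [map_add, map_add, AddMonoidHom.add_comp])

/-- Formula: `levelFunctional h y = inv (nat y ∘ ∂h)`. [cite: Harari2020, §16.3] -/
theorem levelFunctional_apply (h : SC.X₁ ⟶ CS) (y : restrictedCohomology (ρ.tateDual n) S 1) :
    levelFunctional ρ S inv hSC nat h y = inv ((nat y).comp (boundary hSC CS h) (rfl : 1 + 1 = 2)) := rfl

/-- `levelFunctional (ι ≫ q) = 0`: a homomorphism extending to `N₂` has boundary zero.
[cite: MilneADT2006, I Thm. 4.10 (a) (proof, p. 58)] -/
theorem levelFunctional_f_comp (q : SC.X₂ ⟶ CS) : levelFunctional ρ S inv hSC nat (SC.f ≫ q) = 0 := by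
  have h0 : boundary hSC CS (SC.f ≫ q) = 0 := by
    have h := (boundary_eq_boundary_iff hSC (SC.f ≫ q) 0).2 ⟨q, by rw [zero_add]⟩
    rwa [map_zero] at h
  refine AddMonoidHom.ext fun y => ?_
  rw [levelFunctional_apply, h0, Ext.comp_zero, map_zero, AddMonoidHom.zero_apply]

variable [NumberField K] [NeZero n] (Sig : Finset (Place K)) (linv : LocalInvariants K n) {JS : 𝒞}
  (gJ : JS ⟶ CS) (R : ∀ v : Place K, (SC.X₁ ⟶ JS) →+ galoisCohomology (ρ.toLocal v) 1)

/-- **(R4) on the functional**: for `f : N₁ ⟶ JS`, `levelFunctional (f ≫ gJ) y` is the `Σ`-local sum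
`∑_{v ∈ Σ} inv_v(R_v f ∪ y_v)` read in `(1/n)ℤ/ℤ` — verbatim the hypothesis (R4).
[cite: MilneADT2006, I Thm. 4.10 (a) (proof, p. 58), Lemma 4.13] -/
theorem levelFunctional_comp_g
    (hR4 : ∀ (f : SC.X₁ ⟶ JS) (y : restrictedCohomology (ρ.tateDual n) S 1),
      zmodToQmodZ n (∑ v ∈ Sig, localTatePairingZMod ρ n v (linv v) (R v f)
        (restrictedLocalization (ρ.tateDual n) S v 1 y)) =
        inv ((nat y).comp (boundary hSC CS (f ≫ gJ)) (rfl : 1 + 1 = 2)))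
    (f : SC.X₁ ⟶ JS) (y : restrictedCohomology (ρ.tateDual n) S 1) :
    levelFunctional ρ S inv hSC nat (f ≫ gJ) y =
      zmodToQmodZ n (∑ v ∈ Sig, localTatePairingZMod ρ n v (linv v) (R v f)
        (restrictedLocalization (ρ.tateDual n) S v 1 y)) := by
  rw [levelFunctional_apply, hR4]

variable (Ψ : (SC.X₁ ⟶ CS) →+ restrictedCohomology ρ S 2)

/-- **Two `Ψ`-equal homomorphisms have functionals that agree on `Ш¹_S(K, M^D)`**: their difference is
`f ≫ gJ` (`hΨker`), whose functional is a `Σ`-local sum ((R4)), which vanishes on a class with zero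
components at the places of `Σ` (`hSig₁`, `hSig₂`). [cite: MilneADT2006, I Thm. 4.10 (a) (proof, p. 58)] -/
theorem levelFunctional_eq_of_obstruction_eq
    (hSig₂ : ∀ v : HeightOneSpectrum (𝓞 K), (Sum.inr v : Place K) ∈ Sig ↔ v ∈ S)
    (hR4 : ∀ (f : SC.X₁ ⟶ JS) (y : restrictedCohomology (ρ.tateDual n) S 1),
      zmodToQmodZ n (∑ v ∈ Sig, localTatePairingZMod ρ n v (linv v) (R v f)
        (restrictedLocalization (ρ.tateDual n) S v 1 y)) =
        inv ((nat y).comp (boundary hSC CS (f ≫ gJ)) (rfl : 1 + 1 = 2)))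
    (hΨker : ∀ h : SC.X₁ ⟶ CS, Ψ h = 0 → ∃ f : SC.X₁ ⟶ JS, h = f ≫ gJ)
    {h h' : SC.X₁ ⟶ CS} (hhh' : Ψ h = Ψ h') (z : ↥(shaRestricted (ρ.tateDual n) S 1)) :
    levelFunctional ρ S inv hSC nat h z = levelFunctional ρ S inv hSC nat h' z := by
  have hd : Ψ (h - h') = 0 := by rw [map_sub, hhh', sub_self]
  obtain ⟨f, hf⟩ := hΨker _ hd
  have hloc : ∀ v ∈ Sig, restrictedLocalization (ρ.tateDual n) S v 1
      (z : restrictedCohomology (ρ.tateDual n) S 1) = 0 := by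
    rintro (w | v) hv
    · exact ((DiscreteGaloisModule.mem_shaRestricted_iff _ _ _ _).1 z.2).1 w
    · exact ((DiscreteGaloisModule.mem_shaRestricted_iff _ _ _ _).1 z.2).2 v ((hSig₂ v).1 hv)
  have key : levelFunctional ρ S inv hSC nat (h - h') z = 0 := by
    rw [hf, levelFunctional_comp_g ρ S inv hSC nat Sig linv gJ R hR4, Finset.sum_eq_zero fun v hv => ?_,
      map_zero]
    rw [hloc v hv, map_zero]
  rwa [map_sub, AddMonoidHom.sub_apply, sub_eq_zero] at key

/-! ## §2 The pairing, as ONE function of the data -/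

omit [Finite M] [HasExt.{w} 𝒞] [NeZero n] in
/-- A chosen `Ψ`-lift `h_c : N₁ ⟶ CS` of a class `c ∈ Ш²_S(K, M)` (exists by `hΨsurj`; WHICH lift is
irrelevant for the pairing, `levelPairing_apply_of_eq`). [cite: MilneADT2006, I Thm. 4.10 (a) (proof, p. 58)] -/
def shaLift (hΨsurj : ∀ c ∈ shaRestricted ρ S 2, ∃ h : SC.X₁ ⟶ CS, Ψ h = c)
    (c : ↥(shaRestricted ρ S 2)) : SC.X₁ ⟶ CS :=
  (hΨsurj c.1 c.2).choose

omit [Finite M] [HasExt.{w} 𝒞] [NeZero n] in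
/-- `Ψ (shaLift c) = c`. [cite: MilneADT2006, I Thm. 4.10 (a) (proof, p. 58)] -/
theorem obstruction_shaLift (hΨsurj : ∀ c ∈ shaRestricted ρ S 2, ∃ h : SC.X₁ ⟶ CS, Ψ h = c)
    (c : ↥(shaRestricted ρ S 2)) : Ψ (shaLift ρ S Ψ hΨsurj c) = c :=
  (hΨsurj c.1 c.2).choose_spec

/-- **THE PAIRING `Ш²_S(K, M) × Ш¹_S(K, M^D) → ℚ/ℤ` of the readout road**, `(c, z) ↦ inv (nat z ∘ ∂h_c)` for
a `Ψ`-lift `h_c` of `c` — ONE bi-additive map determined by the data `(inv, SC, nat, Ψ)` (additivity in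
`c`: the lifts of `c + c'` and `h_c + h_{c'}` are `Ψ`-equal, `levelFunctional_eq_of_obstruction_eq`).  This
is the pairing of Milne I Thm. 4.10 (a) in the form the presentation road constructs it (proof p. 58:
`Ш²` read in `Ext¹(M^D, C)` modulo `Ext¹(M^D, J)`, paired with `Ш¹` through `α¹`).
[cite: MilneADT2006, I Thm. 4.10 (a) (proof, p. 58)] [cite: Harari2020, §17.5 (proof of Thm. 17.13 (b), p. 302)] -/
def levelPairing
    (hSig₂ : ∀ v : HeightOneSpectrum (𝓞 K), (Sum.inr v : Place K) ∈ Sig ↔ v ∈ S)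
    (hR4 : ∀ (f : SC.X₁ ⟶ JS) (y : restrictedCohomology (ρ.tateDual n) S 1),
      zmodToQmodZ n (∑ v ∈ Sig, localTatePairingZMod ρ n v (linv v) (R v f)
        (restrictedLocalization (ρ.tateDual n) S v 1 y)) =
        inv ((nat y).comp (boundary hSC CS (f ≫ gJ)) (rfl : 1 + 1 = 2)))
    (hΨker : ∀ h : SC.X₁ ⟶ CS, Ψ h = 0 → ∃ f : SC.X₁ ⟶ JS, h = f ≫ gJ)
    (hΨsurj : ∀ c ∈ shaRestricted ρ S 2, ∃ h : SC.X₁ ⟶ CS, Ψ h = c) :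
    ↥(shaRestricted ρ S 2) →+ ↥(shaRestricted (ρ.tateDual n) S 1) →+ AddCircle (1 : ℚ) where
  toFun c := (levelFunctional ρ S inv hSC nat (shaLift ρ S Ψ hΨsurj c)).comp
    (shaRestricted (ρ.tateDual n) S 1).subtype
  map_zero' := by
    refine AddMonoidHom.ext fun z => ?_
    simp only [AddMonoidHom.comp_apply, AddSubgroup.coe_subtype, AddMonoidHom.zero_apply]
    rw [levelFunctional_eq_of_obstruction_eq ρ S inv hSC nat Sig linv gJ R Ψ hSig₂ hR4 hΨker
        (h' := 0) (by rw [obstruction_shaLift, map_zero]; rfl) z, map_zero, AddMonoidHom.zero_apply]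
  map_add' c c' := by
    refine AddMonoidHom.ext fun z => ?_
    simp only [AddMonoidHom.comp_apply, AddSubgroup.coe_subtype, AddMonoidHom.add_apply]
    rw [levelFunctional_eq_of_obstruction_eq ρ S inv hSC nat Sig linv gJ R Ψ hSig₂ hR4 hΨker
        (h' := shaLift ρ S Ψ hΨsurj c + shaLift ρ S Ψ hΨsurj c')
        (by rw [map_add, obstruction_shaLift, obstruction_shaLift, obstruction_shaLift]; rfl) z,
      map_add, AddMonoidHom.add_apply]

/-- **The value does not depend on the lift**: `levelPairing c z = inv (nat z ∘ ∂h)` for EVERY `h` with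
`Ψ h = c`. [cite: MilneADT2006, I Thm. 4.10 (a) (proof, p. 58)] -/
theorem levelPairing_apply_of_eq
    (hSig₂ : ∀ v : HeightOneSpectrum (𝓞 K), (Sum.inr v : Place K) ∈ Sig ↔ v ∈ S)
    (hR4 : ∀ (f : SC.X₁ ⟶ JS) (y : restrictedCohomology (ρ.tateDual n) S 1),
      zmodToQmodZ n (∑ v ∈ Sig, localTatePairingZMod ρ n v (linv v) (R v f)
        (restrictedLocalization (ρ.tateDual n) S v 1 y)) =
        inv ((nat y).comp (boundary hSC CS (f ≫ gJ)) (rfl : 1 + 1 = 2)))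
    (hΨker : ∀ h : SC.X₁ ⟶ CS, Ψ h = 0 → ∃ f : SC.X₁ ⟶ JS, h = f ≫ gJ)
    (hΨsurj : ∀ c ∈ shaRestricted ρ S 2, ∃ h : SC.X₁ ⟶ CS, Ψ h = c)
    (c : ↥(shaRestricted ρ S 2)) {h : SC.X₁ ⟶ CS} (hh : Ψ h = c)
    (z : ↥(shaRestricted (ρ.tateDual n) S 1)) :
    levelPairing ρ S inv hSC nat Sig linv gJ R Ψ hSig₂ hR4 hΨker hΨsurj c z =
      inv ((nat (z : restrictedCohomology (ρ.tateDual n) S 1)).comp (boundary hSC CS h)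
        (rfl : 1 + 1 = 2)) := by
  change levelFunctional ρ S inv hSC nat (shaLift ρ S Ψ hΨsurj c) z = _
  rw [levelFunctional_eq_of_obstruction_eq ρ S inv hSC nat Sig linv gJ R Ψ hSig₂ hR4 hΨker
    (h' := h) (by rw [obstruction_shaLift, hh]) z, levelFunctional_apply]

/-! ## §3 Perfectness -/

/-- **Milne I Thm. 4.10 (a) for `G_S`, `S` finite, ON THE DEFINED PAIRING**: `Ш²_S(K, M)` is finite and
both adjoints of `levelPairing` are bijective.  Hypotheses, all displayed: `Σ = S ∪ Ω_∞` as a finite set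
`Sig`; local invariant maps `linv` perfect at the finite places and representable at the infinite ones
(`harch`); `Ш¹_S(K, M^D)` finite; on the `Ext` side `α¹(N₃)` bijective (`hα`) and `Ext¹(N₂, CS) = 0`
(`hPC`); the readout surjectivity (R3) on `Σ` (`hR3`), the bridge `nat` bijective, the identity (R4); the
five properties of the obstruction map `Ψ`.  Proof = chl-p2's road: the `ℤ/n`-valued readout
`e(c) =` (lift of) `levelFunctional h_c` is additive, injective and surjective modulo `Σ`-local sums,
`shaRestricted_tateDual_of_readout` makes `(c, y) ↦ e(c)(y)` perfect on `Ш²_S × Ш¹_S`, and its values are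
those of `levelPairing` read in `(1/n)ℤ/ℤ`. [cite: MilneADT2006, I Thm. 4.10 (a) (proof, p. 58), Lemma 4.13]
[cite: Harari2020, Thm. 17.13 (b) and §17.5] -/
theorem levelPairing_perfect (hM : ∀ m : M, n • m = 0)
    (hSig₁ : ∀ w : InfinitePlace K, (Sum.inl w : Place K) ∈ Sig)
    (hSig₂ : ∀ v : HeightOneSpectrum (𝓞 K), (Sum.inr v : Place K) ∈ Sig ↔ v ∈ S)
    (hperf : linv.IsPerfect)
    (harch : ∀ (w : InfinitePlace K) (Φ : galoisCohomology ((ρ.tateDual n).toLocal (Sum.inl w)) 1 →+ ZMod n),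
      ∃ t : galoisCohomology (ρ.toLocal (Sum.inl w)) 1,
        ∀ x, Φ x = localTatePairingZMod ρ n (Sum.inl w) (linv (Sum.inl w)) t x)
    [Finite ↥(shaRestricted (ρ.tateDual n) S 1)]
    (hα : Bijective (ExtDuality.adjointMap (P := P) inv SC.X₃ (rfl : 1 + 1 = 2)))
    (hPC : ∀ x : Ext SC.X₂ CS 1, x = 0)
    (hR3 : ∀ t : Π v : Place K, galoisCohomology (ρ.toLocal v) 1,
      ∃ f : SC.X₁ ⟶ JS, ∀ v ∈ Sig, R v f = t v)
    (hnat : Bijective nat)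
    (hR4 : ∀ (f : SC.X₁ ⟶ JS) (y : restrictedCohomology (ρ.tateDual n) S 1),
      zmodToQmodZ n (∑ v ∈ Sig, localTatePairingZMod ρ n v (linv v) (R v f)
        (restrictedLocalization (ρ.tateDual n) S v 1 y)) =
        inv ((nat y).comp (boundary hSC CS (f ≫ gJ)) (rfl : 1 + 1 = 2)))
    (hΨg : ∀ f : SC.X₁ ⟶ JS, Ψ (f ≫ gJ) = 0)
    (hΨf : ∀ q : SC.X₂ ⟶ CS, Ψ (SC.f ≫ q) = 0)
    (hΨker : ∀ h : SC.X₁ ⟶ CS, Ψ h = 0 → ∃ f : SC.X₁ ⟶ JS, h = f ≫ gJ)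
    (hΨsha : ∀ h : SC.X₁ ⟶ CS, Ψ h ∈ shaRestricted ρ S 2)
    (hΨsurj : ∀ c ∈ shaRestricted ρ S 2, ∃ h : SC.X₁ ⟶ CS, Ψ h = c) :
    Finite ↥(shaRestricted ρ S 2) ∧
      Bijective (levelPairing ρ S inv hSC nat Sig linv gJ R Ψ hSig₂ hR4 hΨker hΨsurj) ∧
      Bijective (levelPairing ρ S inv hSC nat Sig linv gJ R Ψ hSig₂ hR4 hΨker hΨsurj).flip := by
  classical
  -- abbreviations
  let B := levelPairing ρ S inv hSC nat Sig linv gJ R Ψ hSig₂ hR4 hΨker hΨsurj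
  let EH := levelFunctional ρ S inv hSC nat
  let lift := shaLift ρ S Ψ hΨsurj
  have hlift : ∀ c : ↥(shaRestricted ρ S 2), Ψ (lift c) = c := obstruction_shaLift ρ S Ψ hΨsurj
  -- `H¹(G_S, M^D)` is `n`-torsion
  have hN1 : ∀ y : restrictedCohomology (ρ.tateDual n) S 1, n • y = 0 :=
    fun y => nsmul_restrictedCohomology_tateDual_eq_zero ρ S n 1 y
  -- the `ℤ/n`-valued lift `eh h` of the functional of `h`
  have hfac : ∀ h : SC.X₁ ⟶ CS, ∃ φ : restrictedCohomology (ρ.tateDual n) S 1 →+ ZMod n,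
      ∀ y, zmodToQmodZ n (φ y) = EH h y := fun h => by
    obtain ⟨φ, hφ⟩ := exists_zmodToQmodZ_comp_eq n hN1 (EH h)
    exact ⟨φ, fun y => DFunLike.congr_fun hφ y⟩
  choose eh heh using hfac
  have heh_sub : ∀ (h h' : SC.X₁ ⟶ CS) (y : restrictedCohomology (ρ.tateDual n) S 1),
      eh (h - h') y = eh h y - eh h' y := fun h h' y => by
    apply zmodToQmodZ_injective n
    rw [map_sub, heh, heh, heh, map_sub, AddMonoidHom.sub_apply]
  -- THE READOUT
  let e : ↥(shaRestricted ρ S 2) → (restrictedCohomology (ρ.tateDual n) S 1 →+ ZMod n) := fun c => eh (lift c)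
  have he : ∀ c, e c = eh (lift c) := fun _ => rfl
  -- the functional of `f ≫ gJ` is a local sum, read in `ℤ/n`
  have hloc : ∀ (f : SC.X₁ ⟶ JS) (y : restrictedCohomology (ρ.tateDual n) S 1),
      eh (f ≫ gJ) y = ∑ v ∈ Sig, localTatePairingZMod ρ n v (linv v) (R v f)
        (restrictedLocalization (ρ.tateDual n) S v 1 y) := fun f y => by
    apply zmodToQmodZ_injective n
    rw [heh]
    exact levelFunctional_comp_g ρ S inv hSC nat Sig linv gJ R hR4 f y
  -- two homomorphisms with the same functional differ by `ι ≫ q`, so have the same `Ψ`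
  have hΨ_eq_of_EH : ∀ h h' : SC.X₁ ⟶ CS, EH h = EH h' → Ψ h = Ψ h' := by
    intro h h' hhh'
    have h1 : ExtDuality.adjointMap (P := P) inv SC.X₃ (rfl : 1 + 1 = 2) (boundary hSC CS h) =
        ExtDuality.adjointMap (P := P) inv SC.X₃ (rfl : 1 + 1 = 2) (boundary hSC CS h') :=
      (AddMonoidHom.cancel_right hnat.2).1 hhh'
    have h2 : boundary hSC CS h = boundary hSC CS h' := hα.1 h1
    obtain ⟨q, hq⟩ := (boundary_eq_boundary_iff hSC h h').1 h2
    rw [hq, map_add, hΨf, add_zero]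
  -- (add): `e` is additive modulo local sums
  have hadd : ∀ c c' : ↥(shaRestricted ρ S 2), ∃ t : Π v : Place K, galoisCohomology (ρ.toLocal v) 1,
      ∀ y : restrictedCohomology (ρ.tateDual n) S 1,
        (e (c + c') - e c - e c') y = ∑ v ∈ Sig, localTatePairingZMod ρ n v (linv v) (t v)
          (restrictedLocalization (ρ.tateDual n) S v 1 y) := by
    intro c c'
    set d : SC.X₁ ⟶ CS := lift (c + c') - lift c - lift c' with hd
    have hΨd : Ψ d = 0 := by
      rw [hd, map_sub, map_sub, hlift, hlift, hlift, AddSubgroup.coe_add, add_sub_cancel_left, sub_self]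
    obtain ⟨f, hf⟩ := hΨker d hΨd
    refine ⟨fun v => R v f, fun y => ?_⟩
    rw [AddMonoidHom.sub_apply, AddMonoidHom.sub_apply, he, he, he, ← heh_sub, ← heh_sub, ← hd, hf]
    exact hloc f y
  -- (inj): a class whose readout is a local sum vanishes
  have hinj : ∀ c : ↥(shaRestricted ρ S 2), (∃ t : Π v : Place K, galoisCohomology (ρ.toLocal v) 1,
      ∀ y : restrictedCohomology (ρ.tateDual n) S 1,
        e c y = ∑ v ∈ Sig, localTatePairingZMod ρ n v (linv v) (t v)
          (restrictedLocalization (ρ.tateDual n) S v 1 y)) → c = 0 := by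
    rintro c ⟨t, hct⟩
    -- `t` is the readout of one `f : N₁ → JS` on `Σ` (R3)
    obtain ⟨f, hf⟩ := hR3 t
    -- the functionals of `h_c` and of `f ≫ gJ` agree
    have hfun : EH (lift c) = EH (f ≫ gJ) := by
      ext y
      rw [← heh, ← heh, ← he, hct y, hloc f y]
      exact congrArg _ (Finset.sum_congr rfl fun v hv => by rw [hf v hv])
    have hΨ := hΨ_eq_of_EH _ _ hfun
    rw [hlift, hΨg] at hΨ
    exact Subtype.ext hΨ
  -- (surj): every character of `H¹(G_S, M^D)` is a readout plus a local sum
  have hsurj : ∀ φ : restrictedCohomology (ρ.tateDual n) S 1 →+ ZMod n, ∃ (c : ↥(shaRestricted ρ S 2))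
      (t : Π v : Place K, galoisCohomology (ρ.toLocal v) 1),
      ∀ y : restrictedCohomology (ρ.tateDual n) S 1,
        (φ - e c) y = ∑ v ∈ Sig, localTatePairingZMod ρ n v (linv v) (t v)
          (restrictedLocalization (ρ.tateDual n) S v 1 y) := by
    intro φ
    -- the character read on `Ext¹(P, N₃)` through `nat`, as `α¹(∂ h)`
    let natE : restrictedCohomology (ρ.tateDual n) S 1 ≃+ Ext P SC.X₃ 1 := AddEquiv.ofBijective nat hnat
    have hnatE : ∀ y, natE y = nat y := fun _ => rfl
    let Φ : Ext P SC.X₃ 1 →+ AddCircle (1 : ℚ) := ((zmodToQmodZ n).comp φ).comp natE.symm.toAddMonoidHom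
    have hΦ : ∀ y, Φ (nat y) = zmodToQmodZ n (φ y) := fun y => by
      change zmodToQmodZ n (φ (natE.symm (nat y))) = _
      rw [← hnatE, AddEquiv.symm_apply_apply]
    obtain ⟨x, hx⟩ := hα.2 Φ
    obtain ⟨h, hh⟩ := boundary_surjective hSC hPC x
    have hEHh : ∀ y, EH h y = zmodToQmodZ n (φ y) := fun y => by
      rw [← hΦ, ← hx, ← hh]
      rfl
    let c : ↥(shaRestricted ρ S 2) := ⟨Ψ h, hΨsha h⟩
    have hΨd : Ψ (lift c - h) = 0 := by rw [map_sub, hlift, sub_self]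
    obtain ⟨f, hf⟩ := hΨker _ hΨd
    refine ⟨c, fun v => R v (-f), fun y => ?_⟩
    have hneg : h - lift c = (-f) ≫ gJ := by
      rw [← neg_sub, hf]
      exact (Preadditive.neg_comp _ _).symm
    have key : eh (h - lift c) y = eh ((-f) ≫ gJ) y := DFunLike.congr_fun (congrArg eh hneg) y
    rw [← hloc (-f) y, ← key, heh_sub, AddMonoidHom.sub_apply, he]
    congr 1
    apply zmodToQmodZ_injective n
    rw [heh, hEHh]
  -- the perfect `ℤ/n`-valued pairing from the readout (finite `S`), transported to `levelPairing`
  obtain ⟨hfin, b, hb, hbij, hbij'⟩ :=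
    shaRestricted_tateDual_of_readout ρ hM S Sig hSig₁ hSig₂ hperf harch e hadd hinj hsurj
  have hshaN : ∀ y : ↥(shaRestricted (ρ.tateDual n) S 1), n • y = 0 :=
    fun y => nsmul_shaRestricted_tateDual_eq_zero ρ S n 1 y
  have hshaTwoN : ∀ c : ↥(shaRestricted ρ S 2), n • c = 0 := fun c => Subtype.ext (by
    rw [AddSubgroupClass.coe_nsmul, AddSubgroup.coe_zero]
    exact ContinuousRep.nsmul_eq_zero_of_forall _ n (fun v => Subtype.ext (by
      rw [Submodule.coe_smul, natCast_zsmul, hM, Submodule.coe_zero])) 2 _)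
  have hbB : ∀ (c : ↥(shaRestricted ρ S 2)) (y : ↥(shaRestricted (ρ.tateDual n) S 1)),
      zmodToQmodZ n (b c y) = B c y := fun c y => by
    rw [hb, he, heh]
    rfl
  exact ⟨hfin, bijective_addCircle_pairing_of_zmod n hshaTwoN hshaN b B hbB hbij hbij'⟩

end ShaReadoutRoad

end Literature.NumberTheory.GaloisCohomology

end
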